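import Literature.AlgebraicGeometry.HodgeTheory.KodairaSpencerObstructionClass
import Literature.AlgebraicGeometry.HodgeTheory.CotangentSheafComap
import Literature.AlgebraicGeometry.HodgeTheory.TwistJetPushforwardIso
import Literature.AlgebraicGeometry.Modules.LinearOverBase
import Literature.AlgebraicGeometry.Modules.PushforwardIsoUnit
import Literature.AlgebraicGeometry.Modules.PushforwardLinear
import Mathlib.Algebra.Homology.DerivedCategory.Ext.Linear
import Mathlib.Algebra.Homology.DerivedCategory.Ext.Map
import Mathlib.Algebra.Module.Submodule.EqLocus
import HarnessLib

/-!
# Equivariant polarised first-order deformations: transport of `T¹(X/S) = Ext¹(Ω¹_{X/S}, 𝒪_X)` along isomorphisms of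
# `S`-schemes, the classes fixed by an automorphism, and the sub-space `T¹(X/S)^{e}_{L}` of `e`-invariant classes along which `L` extends

Layer `Literature/AlgebraicGeometry/Deformation` (definition item `defn-WeilTangentFamilyConstruction`: needs (a) «the action of an
automorphism of `X` on `T¹(X)`» and (b) «the condition “`κ` preserves `L` to first order”» of the request, typed in general).
Everything here is a DEFINITION with a body or a PROVED lemma; no named fact, no `sorry`, no `instance`, no `notation`.

## §1 `T¹(X/S)` and the obstruction homomorphism (existing carriers)

* `DefT1 X := Ext¹_{𝒪_X}(Ω¹_{X/S}, 𝒪_X)` — first-order deformation classes of `X/S`, i.e. truncated Kodaira–Spencer classes of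
  first-order thickenings with ideal `I ≅ 𝒪_X` [HuybrechtsThomas2010, Def. 2.7] (`= H¹(X, 𝒯_{X/S})` for `X/S` smooth,
  [Hartshorne1977, III.6.3 (c), III.6.7]); this is the (unnamed) source type of the TREE's `HodgeTheory.kodairaSpencerObstruction`.
* `kodairaSpencerObstructionHom hΩ hE : DefT1 X →+ Ext²(E, E)` — the tree's obstruction class
  `κ ↦ ob_κ(E) = (id_E ⊗ κ) ∘ At(E)` (`HodgeTheory/KodairaSpencerObstructionClass`, [HuybrechtsThomas2010, Cor. 3.4]) BUNDLED as an
  additive homomorphism from its proved `kodairaSpencerObstruction_zero ∕ _add` (no new class is defined).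

## §2 Transport of `T¹` along an isomorphism of `S`-schemes (need (a))

For `e : X₀ ≅ X₁` in `Over (Spec S)`: `transport e : DefT1 X₀ →+ DefT1 X₁`,
`κ ↦ (Ω¹_{X₁/S} ≅ e_* Ω¹_{X₀/S}) · e_*(κ) · (e_* 𝒪_{X₀} ≅ 𝒪_{X₁})`, assembled from the TREE's `cotangentSheaf.comapIso e`
(`HodgeTheory/CotangentSheafComap`: Hartshorne II 8.11 along an isomorphism), `unitPushforwardIso` (`Modules/PushforwardIsoUnit`),
the exact equivalence `e_*` (`isEquivalence_pushforward_left`, `HodgeTheory/TwistJetPushforwardIso`) and Mathlib's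
`Functor.mapExtAddHom`; and its `S`-LINEAR form `transportLinear e : DefT1 X₀ →ₗ[S] DefT1 X₁` (`Modules.linear_pushforward`;
Mathlib `Ext.smul_comp ∕ comp_smul ∕ Functor.mapExactFunctor_smul`).  For an automorphism `e : X ≅ X` this is the ACTION of `e` on
`T¹(X/S)` (classically `κ ↦ de ∘ κ ∘ e⁻¹` on `H¹(𝒯_X)`).

## §3–§5 Invariant, polarised, and equivariant polarised first-order deformations (need (b))

* `fixedSubmodule e : Submodule S (DefT1 X)` — `T¹(X/S)^{e} = {κ | e • κ = κ}` (`LinearMap.eqLocus`);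
* `polarisedSubgroup hΩ hL : AddSubgroup (DefT1 X) := ker (kodairaSpencerObstructionHom hΩ hL)` — `T¹(X/S)_{L}`, «`κ` preserves `L`
  to first order»: by [HuybrechtsThomas2010, Cor. 3.4] («there is a deformation `E` of `E₀` if and only if
  `0 = (id_{E₀} ⊗ κ(X₀/X)) ∘ A(E₀)`») exactly the classes along which `L` extends to the first-order thickening;
* `equivariantPolarised e hΩ hL : AddSubgroup (DefT1 X) := T¹(X/S)^{e} ⊓ T¹(X/S)_{L}` — **`T¹(X/S)^{e}_{L}`**, the `e`-compatible
  first-order deformations of the polarised scheme `(X, L)`.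

Intended reading (NOT typed here; recorded for the requester): for `X/ℂ` an abelian variety of dimension `2n` with an automorphism
`e = ψ`, `ψ² = -1` (so `K = ℚ(i) ↪ End(X) ⊗ ℚ`), of Weil type, and `L` its polarisation, `T¹(X/ℂ)^{ψ}_{L}` is the tangent space
at `(X, K, L)` to the family of polarised abelian varieties of Weil type, which is `n²`-dimensional [vanGeemen1994HodgeAV, §4.9–4.10
and §5.3].  Need (c) of the request — that dimension count — is a THEOREM about `H¹(X, 𝒯_X)` of an abelian variety which the tree
cannot prove today (no computation of `H¹(X, 𝒯_X)` for abelian varieties); it is NOT asserted anywhere in this file, so the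
problem-side instance (`carrier := T¹(S⁴/ℂ)^{ψ}_{𝒪(λ)}`, `finrank_carrier`) keeps (c) as its one open obligation.
An `S`-submodule form of `T¹(X/S)_{L}` needs `S`-linearity of `E ⊗ –` on morphisms for the base-`S` structure, not recorded in
the tree; the additive form is what [HuybrechtsThomas2010] states.
-/

noncomputable section

set_option autoImplicit false

open CategoryTheory CategoryTheory.Abelian CategoryTheory.Limits AlgebraicGeometry
open AlgebraicGeometry.Scheme.Modules
open Literature.AlgebraicGeometry Literature.AlgebraicGeometry.Modules Literature.AlgebraicGeometry.Motives
open Literature.AlgebraicGeometry.HodgeTheory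

namespace Literature.AlgebraicGeometry.Deformation.FirstOrder

universe w w' u

/-! ## §1 `T¹(X/S)` and the obstruction homomorphism `κ ↦ (id_E ⊗ κ) ∘ At(E)` (bundling the tree's class) -/

section General

variable {S : Type u} [CommRing S] (X : Over (Spec (CommRingCat.of S))) [HasExt.{w} X.left.Modules]

/-- **`T¹(X/S) := Ext¹_{𝒪_X}(Ω¹_{X/S}, 𝒪_X)`** — first-order deformation classes of `X/S` as morphisms `κ : Ω¹_{X/S} → 𝒪_X[1]`: the
truncated Kodaira–Spencer class of a first-order thickening with ideal `I ≅ 𝒪_X` («the truncated Kodaira–Spencer class of the square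
zero extension `i : X₀ ↪ X` is the extension class `κ(X₀/X) ∈ Ext¹_{X₀}(𝕃_{X₀}, I)`», with `𝕃 = Ω¹_{X/S}` here); `= H¹(X, 𝒯_{X/S})` for
`X/S` smooth. [cite: HuybrechtsThomas2010, Def. 2.7 (arXiv p. 7)] [cite: Hartshorne1977, III.6.3 (c), III.6.7] -/
abbrev DefT1 : Type w := Ext.{w} (cotangentSheaf X) (unitModule X.left) 1

variable {X} (hΩ : IsFiniteLocallyFree (cotangentSheaf X)) {E : X.left.Modules} (hE : IsFiniteLocallyFree E)

/-- **`ob_E : T¹(X/S) →+ Ext²(E, E)`, `κ ↦ ob_κ(E) = (id_E ⊗ κ) ∘ At(E)`** — the tree's `HodgeTheory.kodairaSpencerObstruction hΩ hE`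
(«there is a deformation `E` of `E₀` if and only if `0 = (id_{E₀} ⊗ κ(X₀/X)) ∘ A(E₀) ∈ Ext²_{X₀}(E₀, E₀ ⊗ I)`») bundled as an
additive homomorphism (`kodairaSpencerObstruction_zero`, `kodairaSpencerObstruction_add`). [cite: HuybrechtsThomas2010, Cor. 3.4 (arXiv p. 10)] -/
def kodairaSpencerObstructionHom : DefT1 X →+ Ext.{w} E E 2 where
  toFun := kodairaSpencerObstruction hΩ hE
  map_zero' := kodairaSpencerObstruction_zero hΩ hE
  map_add' := kodairaSpencerObstruction_add hΩ hE

/-- `kodairaSpencerObstructionHom hΩ hE κ = kodairaSpencerObstruction hΩ hE κ`. [cite: HuybrechtsThomas2010, Cor. 3.4 (arXiv p. 10)] -/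
@[simp] lemma kodairaSpencerObstructionHom_apply (κ : DefT1 X) :
    kodairaSpencerObstructionHom hΩ hE κ = kodairaSpencerObstruction hΩ hE κ := rfl

end General

/-! ## §2 Transport of `T¹(X/S)` along an isomorphism of `S`-schemes (need (a): the action of an automorphism on `T¹`) -/

section Transport

variable {S : Type u} [CommRing S] {X₀ X₁ : Over (Spec (CommRingCat.of S))} (e : X₀ ≅ X₁)
  [HasExt.{w} X₀.left.Modules] [HasExt.{w'} X₁.left.Modules]

/-- **Transport of first-order deformation classes along an isomorphism `e : X₀ ≅ X₁` of `S`-schemes**,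
`T¹(X₀/S) → T¹(X₁/S)`, `κ ↦ (Ω¹_{X₁/S} ≅ e_* Ω¹_{X₀/S}) · e_*(κ) · (e_* 𝒪_{X₀} ≅ 𝒪_{X₁})`: the exact equivalence `e_*`
(`isEquivalence_pushforward_left`) on `Ext¹` (Mathlib `Functor.mapExtAddHom`), pre-composed with the pull-back of differentials
`e^♯ : Ω¹_{X₁/S} ≅ e_* Ω¹_{X₀/S}` (`cotangentSheaf.comapIso`) and post-composed with `(e♯)⁻¹ : e_* 𝒪_{X₀} ≅ 𝒪_{X₁}`
(`unitPushforwardIso`).  For `X₀ = X₁ = X` this is the action of the automorphism `e` on `T¹(X/S)`.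
[cite: Hartshorne1977, II Prop. 8.11 (f^*Ω_{Y/Z} → Ω_{X/Z}; reading: an isomorphism for f an isomorphism) and III §6 (functoriality of Ext)]
[cite: HuybrechtsThomas2010, Def. 2.7 (arXiv p. 7)] -/
def transport : DefT1.{w} X₀ →+ DefT1.{w'} X₁ :=
  ((Ext.mk₀ (unitPushforwardIso (leftIso' e)).inv).postcomp (cotangentSheaf X₁) (add_zero 1)).comp
    (((Ext.mk₀ (cotangentSheaf.comapIso e).hom).precomp
          ((pushforward e.hom.left).obj (unitModule X₀.left)) (zero_add 1)).comp
      ((pushforward e.hom.left).mapExtAddHom (cotangentSheaf X₀) (unitModule X₀.left) 1))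

/-- Unfolding `transport`: `e • κ = (e^♯ · e_*κ) · (e♯)⁻¹`. [cite: Hartshorne1977, II Prop. 8.11 and III §6] -/
lemma transport_apply (κ : DefT1.{w} X₀) :
    transport e κ =
      ((Ext.mk₀ (cotangentSheaf.comapIso e).hom).comp
          (κ.mapExactFunctor (pushforward e.hom.left)) (zero_add 1)).comp
        (Ext.mk₀ (unitPushforwardIso (leftIso' e)).inv) (add_zero 1) := rfl

/-- `e • 0 = 0`. [cite: Hartshorne1977, III §6 (Ext is additive)] -/
lemma transport_zero : transport e (0 : DefT1.{w} X₀) = 0 := map_zero _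

/-- **`transport e` is `S`-linear** (`e_*` is an `S`-linear functor for the base-`S` structure, `Modules.linear_pushforward`; Yoneda
composition is `S`-bilinear). [cite: Hartshorne1977, II Prop. 8.11 and III §6] [cite: GortzWedhorn2020, §(7.3), (7.3.6) (the Γ(X,𝒪_X)-module structure on Hom, compatible with f_*)] -/
lemma transport_smul (c : S) (κ : DefT1.{w} X₀) : transport e (c • κ) = c • transport e κ := by
  haveI : (pushforward e.hom.left).Linear S := linear_pushforward e.hom
  rw [transport_apply, transport_apply, Functor.mapExactFunctor_smul, Ext.comp_smul, Ext.smul_comp]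

/-- **The `S`-linear transport `T¹(X₀/S) →ₗ[S] T¹(X₁/S)`** (same map as `transport`). [cite: Hartshorne1977, II Prop. 8.11 and III §6] -/
def transportLinear : DefT1.{w} X₀ →ₗ[S] DefT1.{w'} X₁ where
  toFun := transport e
  map_add' := map_add _
  map_smul' c κ := transport_smul e c κ

/-- `transportLinear e κ = transport e κ`. [cite: Hartshorne1977, II Prop. 8.11 and III §6] -/
@[simp] lemma transportLinear_apply (κ : DefT1.{w} X₀) : transportLinear e κ = transport e κ := rfl

end Transport

/-! ## §3 First-order deformations fixed by an automorphism -/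

section Fixed

variable {S : Type u} [CommRing S] {X : Over (Spec (CommRingCat.of S))} (e : X ≅ X) [HasExt.{w} X.left.Modules]

/-- **`T¹(X/S)^{e}` — the first-order deformation classes fixed by the automorphism `e` of `X/S`**: `{κ | e • κ = κ}`, an
`S`-submodule (`LinearMap.eqLocus` of `transportLinear e` and the identity): the first-order deformations of `X/S` compatible with
`e` (to which `e` lifts).  For an abelian variety with `ψ`, `ψ² = -1`, these are the «`ψ`-compatible» directions.
[cite: Hartshorne1977, II Prop. 8.11 and III §6 (functoriality; reading: the invariants of the induced action)] -/
def fixedSubmodule : Submodule S (DefT1.{w} X) :=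
  LinearMap.eqLocus (transportLinear.{w, w} e) LinearMap.id

/-- membership in `T¹(X/S)^{e}`: `κ` is fixed iff `e • κ = κ`. [cite: Hartshorne1977, II Prop. 8.11 and III §6] -/
lemma mem_fixedSubmodule_iff (κ : DefT1.{w} X) : κ ∈ fixedSubmodule e ↔ transport e κ = κ := Iff.rfl

/-- `0 ∈ T¹(X/S)^{e}`. [cite: Hartshorne1977, III §6] -/
lemma zero_mem_fixedSubmodule : (0 : DefT1.{w} X) ∈ fixedSubmodule e := Submodule.zero_mem _

end Fixed

/-! ## §4 First-order deformations along which a bundle extends («`κ` preserves `L` to first order») -/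

section Polarised

variable {S : Type u} [CommRing S] {X : Over (Spec (CommRingCat.of S))} [HasExt.{w} X.left.Modules]
  (hΩ : IsFiniteLocallyFree (cotangentSheaf X)) {L : X.left.Modules} (hL : IsFiniteLocallyFree L)

/-- **`T¹(X/S)_{L} := ker ob_L` — the first-order deformation classes along which `L` extends** («`κ` preserves `L` to first order»,
`(id_L ⊗ κ) ∘ At(L) = 0 ∈ Ext²(L, L)`): «there is a deformation `E` of `E₀` if and only if `0 = (id_{E₀} ⊗ κ(X₀/X)) ∘ A(E₀)`».
Stated for any finite locally free `L` (intended: the polarisation line bundle). [cite: HuybrechtsThomas2010, Cor. 3.4 (arXiv p. 10)] -/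
def polarisedSubgroup : AddSubgroup (DefT1.{w} X) := (kodairaSpencerObstructionHom hΩ hL).ker

/-- membership: `κ ∈ T¹(X/S)_{L} ↔ ob_κ(L) = 0`. [cite: HuybrechtsThomas2010, Cor. 3.4 (arXiv p. 10)] -/
lemma mem_polarisedSubgroup_iff (κ : DefT1.{w} X) : κ ∈ polarisedSubgroup hΩ hL ↔ kodairaSpencerObstruction hΩ hL κ = 0 :=
  AddMonoidHom.mem_ker

/-- `0 ∈ T¹(X/S)_{L}` (the trivial deformation preserves every bundle). [cite: HuybrechtsThomas2010, Cor. 3.4 (arXiv p. 10)] -/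
lemma zero_mem_polarisedSubgroup : (0 : DefT1.{w} X) ∈ polarisedSubgroup hΩ hL := AddSubgroup.zero_mem _

/-- if `Ext²(L, L)` is subsingleton every class preserves `L`: `T¹(X/S)_{L} = ⊤` (the «`H²`-unobstructed» case).
[cite: HuybrechtsThomas2010, Cor. 3.4 (arXiv p. 10)] -/
lemma polarisedSubgroup_eq_top_of_subsingleton [Subsingleton (Ext.{w} L L 2)] : polarisedSubgroup hΩ hL = ⊤ :=
  (AddSubgroup.eq_top_iff' _).2 fun _ => (mem_polarisedSubgroup_iff hΩ hL _).2 (Subsingleton.elim _ _)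

end Polarised

/-! ## §5 `T¹(X/S)^{e}_{L}` — equivariant polarised first-order deformations -/

section EquivariantPolarised

variable {S : Type u} [CommRing S] {X : Over (Spec (CommRingCat.of S))} (e : X ≅ X) [HasExt.{w} X.left.Modules]
  (hΩ : IsFiniteLocallyFree (cotangentSheaf X)) {L : X.left.Modules} (hL : IsFiniteLocallyFree L)

/-- **`T¹(X/S)^{e}_{L}` — the `e`-invariant first-order deformations of the polarised scheme `(X, L)`**: classes `κ` with `e • κ = κ`
along which `L` extends, `T¹(X/S)^{e} ⊓ T¹(X/S)_{L}`.  Intended reading (not typed): for `X/ℂ` an abelian variety of dimension `2n`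
with `e = ψ`, `ψ² = -1`, of Weil type, and `L` its polarisation, this is the tangent space at `(X, ℚ(i), L)` to the `n²`-dimensional
family of polarised abelian varieties of Weil type; the dimension statement is NOT asserted here.
[cite: HuybrechtsThomas2010, Cor. 3.4 (arXiv p. 10)] [cite: vanGeemen1994HodgeAV, §4.9–4.10 and §5.3 (polarized abelian varieties of Weil type lie in n²-dimensional families; reading, context only)] -/
def equivariantPolarised : AddSubgroup (DefT1.{w} X) :=
  (fixedSubmodule e).toAddSubgroup ⊓ polarisedSubgroup hΩ hL

/-- membership: `κ ∈ T¹(X/S)^{e}_{L} ↔ e • κ = κ ∧ ob_κ(L) = 0`. [cite: HuybrechtsThomas2010, Cor. 3.4 (arXiv p. 10)] -/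
lemma mem_equivariantPolarised_iff (κ : DefT1.{w} X) :
    κ ∈ equivariantPolarised e hΩ hL ↔ transport e κ = κ ∧ kodairaSpencerObstruction hΩ hL κ = 0 := by
  rw [equivariantPolarised, AddSubgroup.mem_inf, Submodule.mem_toAddSubgroup, mem_fixedSubmodule_iff,
    mem_polarisedSubgroup_iff]

/-- `T¹(X/S)^{e}_{L} ≤ T¹(X/S)^{e}`. [cite: HuybrechtsThomas2010, Cor. 3.4 (arXiv p. 10)] -/
lemma equivariantPolarised_le_fixed : equivariantPolarised e hΩ hL ≤ (fixedSubmodule e).toAddSubgroup := inf_le_left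

/-- `T¹(X/S)^{e}_{L} ≤ T¹(X/S)_{L}`. [cite: HuybrechtsThomas2010, Cor. 3.4 (arXiv p. 10)] -/
lemma equivariantPolarised_le_polarised : equivariantPolarised e hΩ hL ≤ polarisedSubgroup hΩ hL := inf_le_right

/-- `L` is first-order unobstructed along `T¹(X/S)^{e}_{L}`: `∀ κ ∈ T¹(X/S)^{e}_{L}, ob_κ(L) = 0` (by construction).
[cite: HuybrechtsThomas2010, Cor. 3.4 (arXiv p. 10)] -/
lemma kodairaSpencerObstruction_eq_zero_of_mem_equivariantPolarised {κ : DefT1.{w} X} (hκ : κ ∈ equivariantPolarised e hΩ hL) :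
    kodairaSpencerObstruction hΩ hL κ = 0 :=
  ((mem_equivariantPolarised_iff e hΩ hL κ).1 hκ).2

/-- every class of `T¹(X/S)^{e}_{L}` is fixed by `e`. [cite: Hartshorne1977, II Prop. 8.11 and III §6] -/
lemma transport_eq_self_of_mem_equivariantPolarised {κ : DefT1.{w} X} (hκ : κ ∈ equivariantPolarised e hΩ hL) :
    transport e κ = κ :=
  ((mem_equivariantPolarised_iff e hΩ hL κ).1 hκ).1

/-- `0 ∈ T¹(X/S)^{e}_{L}`. [cite: HuybrechtsThomas2010, Cor. 3.4 (arXiv p. 10)] -/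
lemma zero_mem_equivariantPolarised : (0 : DefT1.{w} X) ∈ equivariantPolarised e hΩ hL := AddSubgroup.zero_mem _

end EquivariantPolarised

end Literature.AlgebraicGeometry.Deformation.FirstOrder

end
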